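import Literature.Geometry.Lorentzian.NonRotatingBlackHoleUniqueness
import Literature.Geometry.Lorentzian.EventHorizonSurfaceGravity
import HarnessLib

/-!
# The non-rotating horizon-Killing step in the SMOOTH category, with a Killing collar
# (Chruściel–Costa 2008, §7.2 ¶1 with Cor. 3.3, Thm. 4.11 and §2.3 (2.8); the zeroth law)

Topic `Literature/Geometry/Lorentzian`; companion of `StationaryBlackHoleUniquenessCases.lean`
(`ChruscielCosta2008_nonRotating_horizonKilling`: the same step stated under the standing
ANALYTICITY of Chruściel–Costa's Thm. 1.3 and the GLOBAL `IsNonDegenerateHorizon`) and of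
`EventHorizonSurfaceGravity.lean` (`VacuumHorizonZerothLaw`: the Killing-COLLAR vocabulary —
`IsKillingFieldOn K U` on an open `U ⊇ 𝓔⁺`, `[T, K] = 0` on `U`, local tangency through integral
curves — which is followed here VERBATIM). Requested by cite item wi-37828 for route
`HorizonTypeCascade` (support `NonRotatingConnectedIsKerr`, leaf 2a of its cascade): the
analyticity-free collar version, whose conclusion is verbatim the horizon hypothesis of
`SudarskyWald1993_staticity`; its composition with that fact and with
`ChruscielGalloway2010_docStaticUniqueness` down to a Kerr (indeed Schwarzschild) exterior is
PROVED below (`…collar.isIsometricToKerrExterior`).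

## What is printed (Chruściel–Costa 2008 = arXiv:0806.0016, held text; all in the SMOOTH category)

* §7.2, first paragraph (held text p. 34): "The case where the stationary Killing vector `X` is
  tangent to the generators of every component of `𝓗⁺` will be referred to as the non-rotating
  one. By hypothesis `∇(g(X, X))` has no zeros on `𝓔⁺`, so all components of the future event
  horizon are non-degenerate."
* §2.3 (p. 7): "A null hypersurface, invariant under the flow of a Killing vector `X`, which
  coincides with a connected component of the set `𝓝(X) := {g(X, X) = 0, X ≠ 0}`, is called a
  Killing horizon associated to `X`. … The surface gravity `κ` of a Killing horizon `𝓝` is defined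
  by the formula (2.8) `d(g(X, X))|_𝓝 = -2κ X♭` … A fundamental property is that the surface
  gravity `κ` is constant over each horizon in vacuum, or in electro-vacuum, see e.g. [Heusler];
  the proof given in [Wald] generalizes … A Killing horizon is called degenerate if `κ` vanishes,
  and non-degenerate otherwise." (Zeroth law: Bardeen–Carter–Hawking 1973 §3; Wald 1984 §12.5,
  (12.5.24)–(12.5.31); in the tree as the named fact `VacuumHorizonZerothLaw`.)
* Cor. 3.3 (§3 "Zeros of Killing vectors", p. 9; no analyticity in §3): "If `r ∈ S̄ ∩ I⁺(M_ext)`,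
  then the stationary Killing vector `X` does not vanish at `r`. In particular if `(M, g)` is
  `I⁺`-regular, then `X` has no zeros on `S̄`."
* Thm. 4.11 (§4.3 "Smoothness of event horizons", p. 16): "Let `(M, g)` be a smooth,
  asymptotically flat, `(n+1)`-dimensional space-time with stationary Killing vector `K₀`, the
  orbits of which are complete. Suppose that `⟨⟨M_ext⟩⟩` is globally hyperbolic, vacuum at large
  distances in the asymptotic region, and assume that the null energy condition holds. Assume that
  a connected component `𝓗₀` of `𝓗 := 𝓗⁻ ∪ 𝓗⁺` admits a compact cross-section satisfying
  `S ⊂ I⁺(M_ext)`. If … there exists in `⟨⟨M_ext⟩⟩` a spacelike hypersurface `𝒮 ⊃ 𝒮_ext`,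
  achronal in `⟨⟨M_ext⟩⟩`, so that `S = ∂𝒮̄ ⊂ 𝓔⁺`, then `∪ₜ φₜ[K₀](S) ⊂ 𝓗₀` is a smooth null
  hypersurface, which is analytic if the metric is." (For `I⁺`-regular `(M, g)`:
  `𝓔⁺ = ∪ₜ φₜ(∂𝒮̄)`, §4.1.)

## The vendored statement and how it follows (smooth category throughout)

HYPOTHESES: `𝓑 : StationaryAFBlackHole` `I⁺`-regular and vacuum, `𝓔⁺ = 𝓑.horizon` connected; a
NON-DEGENERATE KILLING COLLAR — a vector field `K`, Killing on an open `U ⊇ 𝓔⁺`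
(`IsKillingFieldOn`), commuting with `T = 𝓑.killing` on `U` (`mlieBracket T K = 0`), nowhere zero
on `𝓔⁺`, locally tangent to `𝓔⁺` (through every `p ∈ 𝓔⁺` an integral curve of `K` on a short open
interval stays in `𝓔⁺`), with `∇_K K = κ K` on `𝓔⁺` for one constant `κ ≠ 0` (so `K` is null on
`𝓔⁺`: `0 = g(∇_K K, K) = κ g(K, K)`, `IsKillingField.val_self_eq_zero_of_leviCivita_eq_smul`); and
`T` NULL on `𝓔⁺` (`g(T, T) = 0` at every point of `𝓔⁺` — "`X` tangent to the generators", the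
non-rotating case). CONCLUSION: `T` has no zeros on `𝓔⁺` and `∇_T T = κ_T T` on `𝓔⁺` for ONE
constant `κ_T ≠ 0` — verbatim the horizon hypothesis of `SudarskyWald1993_staticity`.
HOW (each sentence printed or elementary): `T` has no zeros on `∂𝒮̄` (Cor. 3.3), hence none on
`𝓔⁺ = ∪ₜ φₜ(∂𝒮̄)` (`T` is invariant under its own flow); `𝓔⁺` is a smooth connected null
hypersurface invariant under both flows (Thm. 4.11), so the null tangent vectors `T` and `K` are
both proportional to its null normal: `T = f K` on `𝓔⁺` with `f` smooth and nowhere zero;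
`[T, K] = 0` gives `K(f) = 0`, whence `∇_T T = f ∇_K (f K) = f² κ K = (f κ) T`, i.e. `𝓔⁺` is a
Killing horizon of `T` ((2.8)) with surface gravity `κ_T = f κ`, nowhere zero, and constant on the
connected `𝓔⁺` by the zeroth law in vacuum — "all components of the future event horizon are
non-degenerate" for `X = T`, which is what §7.2 then feeds into the Sudarsky–Wald argument. The
differences with `ChruscielCosta2008_nonRotating_horizonKilling` are exactly: NO analyticity (none
of Cor. 3.3, Thm. 4.11, (2.8), the zeroth law uses it; in Chruściel–Costa 2008 analyticity enters
Thm. 1.3 only through the rigidity theorem of §4.4, i.e. the ROTATING case §7.1), and the collar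
`K` on `U ⊇ 𝓔⁺` commuting with `T` in place of a global Killing field.

## References

* [ChruscielCosta2008] Astérisque 321 (2008) 195–265 = arXiv:0806.0016: §7.2 ¶1; §2.3 (2.8)–(2.10);
  §3 Cor. 3.3 (and Lemma 3.7 / Cor. 3.8); §4.1, §4.3 Thm. 4.11.
* [Heusler1996] M. Heusler, *Black Hole Uniqueness Theorems*, CUP 1996, §6.1–6.3 (Killing horizons,
  zeroth law).
* [Wald1984] R. M. Wald, *General Relativity*, §12.5; [BardeenCarterHawking1973] §3.
-/

noncomputable section

open scoped Manifold ContDiff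

namespace Literature.Geometry.Lorentzian

open Set Function

/-- **Chruściel–Costa 2008, §7.2 ¶1 in the smooth category, with a Killing collar: in the
non-rotating case the stationary Killing field is itself a non-degenerate horizon Killing field.**
Let `𝓑` be a four-dimensional stationary AF black hole (`StationaryAFBlackHole`) which is
`I⁺`-regular and vacuum (smooth, NOT assumed analytic), with CONNECTED future event horizon
`𝓔⁺ = 𝓑.horizon` carrying a non-degenerate Killing collar: `K` Killing on an open `U ⊇ 𝓔⁺`
(`IsKillingFieldOn`), `[T, K] = 0` on `U` (`T = 𝓑.killing`), `K` nowhere zero on `𝓔⁺` and locally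
tangent to it (integral curves of `K` through points of `𝓔⁺` stay in `𝓔⁺` for a short time), and
`∇_K K = κ K` on `𝓔⁺` for one constant `κ ≠ 0`; and suppose `T` is NULL on `𝓔⁺` (`g(T, T) = 0` at
every point of `𝓔⁺`: "`X` tangent to the generators of every component of `𝓗⁺` … the non-rotating
[case]"). Then `T` has no zeros on `𝓔⁺` and `∇_T T = κ' T` on `𝓔⁺` for a single NON-ZERO
constant `κ'` — verbatim the horizon hypothesis of `SudarskyWald1993_staticity`. Printed
ingredients, all smooth-category (module docstring): `T ≠ 0` on `∂𝒮̄` (Cor. 3.3) hence on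
`𝓔⁺ = ∪ₜ φₜ(∂𝒮̄)`; `𝓔⁺` a smooth null hypersurface (Thm. 4.11), so `T = f K` there, `K(f) = 0` by
`[T, K] = 0`, `∇_T T = (f κ) T` (Killing horizon of `T`, (2.8)); `κ' = f κ ≠ 0` constant by the
zeroth law in vacuum ("all components of the future event horizon are non-degenerate"). Differs
from `ChruscielCosta2008_nonRotating_horizonKilling` exactly by dropping analyticity and
localising the horizon Killing field to a collar commuting with `T`. A named fact (D-0014).
[cite: ChruscielCosta2008, §7.2 (first paragraph) with §2.3 (2.8)–(2.10), Cor. 3.3 and Thm. 4.11]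
[cite: Heusler1996, §6.1–6.3 (Killing horizons, zeroth law)]
[cite: Wald1984, §12.5 (zeroth law, (12.5.24)–(12.5.31))] -/
def ChruscielCosta2008_nonRotating_horizonKilling_collar : Prop :=
  ∀ (𝓑 : StationaryAFBlackHole.{0}) [𝓑.metric.HasLeviCivita],
    𝓑.IsIPlusRegular → 𝓑.metric.toPseudoRiemannianMetric.IsRicciFlat → IsConnected 𝓑.horizon →
    ∀ (U : Set 𝓑.carrier) (K : Π x : 𝓑.carrier, TangentSpace (𝓡 4) x),
      IsOpen U → 𝓑.horizon ⊆ U → 𝓑.metric.toPseudoRiemannianMetric.IsKillingFieldOn K U →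
      (∀ x ∈ U, VectorField.mlieBracket (𝓡 4) 𝓑.killing K x = 0) →
      (∀ p ∈ 𝓑.horizon, K p ≠ 0) →
      (∀ p ∈ 𝓑.horizon, ∃ ε > (0 : ℝ), ∃ γ : ℝ → 𝓑.carrier, γ 0 = p ∧
        IsMIntegralCurveOn γ K (Set.Ioo (-ε) ε) ∧ ∀ t ∈ Set.Ioo (-ε) ε, γ t ∈ 𝓑.horizon) →
      (∃ κ : ℝ, κ ≠ 0 ∧ ∀ p ∈ 𝓑.horizon, 𝓑.metric.leviCivita K p (K p) = κ • K p) →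
      (∀ p ∈ 𝓑.horizon, 𝓑.metric.val p (𝓑.killing p) (𝓑.killing p) = 0) →
      (∀ p ∈ 𝓑.horizon, 𝓑.killing p ≠ 0) ∧
        ∃ κ' : ℝ, κ' ≠ 0 ∧ ∀ p ∈ 𝓑.horizon,
          𝓑.metric.leviCivita 𝓑.killing p (𝓑.killing p) = κ' • 𝓑.killing p

/-- **Non-rotating + non-degenerate collar ⟹ static d.o.c.** (given the two named facts): the
collar step feeds `SudarskyWald1993_staticity` (Chruściel–Costa 2008, §7.2: the Sudarsky–Wald
argument), so `T` is hypersurface-orthogonal on `⟨⟨M_ext⟩⟩`.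
[cite: ChruscielCosta2008, §7.2] -/
theorem ChruscielCosta2008_nonRotating_horizonKilling_collar.staticity
    (h : ChruscielCosta2008_nonRotating_horizonKilling_collar) (hSW : SudarskyWald1993_staticity)
    (𝓑 : StationaryAFBlackHole.{0}) [𝓑.metric.HasLeviCivita] (hreg : 𝓑.IsIPlusRegular)
    (hvac : 𝓑.metric.toPseudoRiemannianMetric.IsRicciFlat) (hconn : IsConnected 𝓑.horizon)
    {U : Set 𝓑.carrier} {K : Π x : 𝓑.carrier, TangentSpace (𝓡 4) x} (hU : IsOpen U)
    (hHU : 𝓑.horizon ⊆ U) (hK : 𝓑.metric.toPseudoRiemannianMetric.IsKillingFieldOn K U)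
    (hTK : ∀ x ∈ U, VectorField.mlieBracket (𝓡 4) 𝓑.killing K x = 0)
    (hne : ∀ p ∈ 𝓑.horizon, K p ≠ 0)
    (htan : ∀ p ∈ 𝓑.horizon, ∃ ε > (0 : ℝ), ∃ γ : ℝ → 𝓑.carrier, γ 0 = p ∧
      IsMIntegralCurveOn γ K (Set.Ioo (-ε) ε) ∧ ∀ t ∈ Set.Ioo (-ε) ε, γ t ∈ 𝓑.horizon)
    (hκ : ∃ κ : ℝ, κ ≠ 0 ∧ ∀ p ∈ 𝓑.horizon, 𝓑.metric.leviCivita K p (K p) = κ • K p)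
    (hnull : ∀ p ∈ 𝓑.horizon, 𝓑.metric.val p (𝓑.killing p) (𝓑.killing p) = 0) :
    𝓑.metric.toPseudoRiemannianMetric.IsHypersurfaceOrthogonalOn 𝓑.killing 𝓑.doc := by
  obtain ⟨hT0, hκ'⟩ := h 𝓑 hreg hvac hconn U K hU hHU hK hTK hne htan hκ hnull
  exact hSW 𝓑 hreg hvac hconn.nonempty hT0 hκ'

/-- **Leaf "non-rotating connected ⟹ Kerr" from the three named facts** (Chruściel–Costa 2008,
§7.2 in the smooth category: collar step, Sudarsky–Wald staticity, static uniqueness with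
analyticity removed by Chruściel–Galloway 2010, and Schwarzschild ⊂ Kerr,
`IsIsometricToSchwarzschildExterior.isIsometricToKerrExterior`): an `I⁺`-regular vacuum
stationary AF black hole with connected `𝓔⁺` carrying a non-degenerate Killing collar commuting
with `T`, and with `T` null on `𝓔⁺`, has `⟨⟨M_ext⟩⟩` isometric to a Kerr exterior (with `a = 0`).
[cite: ChruscielCosta2008, §7.2 and Thm. 1.4] [cite: ChruscielGalloway2010, Thm. 1.1, Thm. 4.1] -/
theorem ChruscielCosta2008_nonRotating_horizonKilling_collar.isIsometricToKerrExterior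
    (h : ChruscielCosta2008_nonRotating_horizonKilling_collar) (hSW : SudarskyWald1993_staticity)
    (hCG : ChruscielGalloway2010_docStaticUniqueness)
    (𝓑 : StationaryAFBlackHole.{0}) [𝓑.metric.HasLeviCivita] [Kerr.Facts]
    (hF : 𝓑.metric.isOpen_chronologicalFuture 𝓑.timeOrientation)
    (hP : 𝓑.metric.isOpen_chronologicalPast 𝓑.timeOrientation)
    (hres : PseudoRiemannianMetric.contMDiff_restrict (I := 𝓡 4) (n := ∞) (M := 𝓑.carrier))
    (hreg : 𝓑.IsIPlusRegular) (hvac : 𝓑.metric.toPseudoRiemannianMetric.IsRicciFlat)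
    (hconn : IsConnected 𝓑.horizon)
    {U : Set 𝓑.carrier} {K : Π x : 𝓑.carrier, TangentSpace (𝓡 4) x} (hU : IsOpen U)
    (hHU : 𝓑.horizon ⊆ U) (hK : 𝓑.metric.toPseudoRiemannianMetric.IsKillingFieldOn K U)
    (hTK : ∀ x ∈ U, VectorField.mlieBracket (𝓡 4) 𝓑.killing K x = 0)
    (hne : ∀ p ∈ 𝓑.horizon, K p ≠ 0)
    (htan : ∀ p ∈ 𝓑.horizon, ∃ ε > (0 : ℝ), ∃ γ : ℝ → 𝓑.carrier, γ 0 = p ∧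
      IsMIntegralCurveOn γ K (Set.Ioo (-ε) ε) ∧ ∀ t ∈ Set.Ioo (-ε) ε, γ t ∈ 𝓑.horizon)
    (hκ : ∃ κ : ℝ, κ ≠ 0 ∧ ∀ p ∈ 𝓑.horizon, 𝓑.metric.leviCivita K p (K p) = κ • K p)
    (hnull : ∀ p ∈ 𝓑.horizon, 𝓑.metric.val p (𝓑.killing p) (𝓑.killing p) = 0) :
    𝓑.IsIsometricToKerrExterior hF hP hres :=
  (hCG 𝓑 hF hP hres hreg (h.staticity hSW 𝓑 hreg hvac hconn hU hHU hK hTK hne htan hκ hnull)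
    hvac hconn.nonempty).isIsometricToKerrExterior

end Literature.Geometry.Lorentzian

end
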